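import Summits.BirchSwinnertonDyer.BirchSwinnertonDyer.Theses.UniversalToricDescent
import Summits.BirchSwinnertonDyer.BirchSwinnertonDyer.Theorems.EisensteinPrimesHidaLimitFittingBoundConverse
import Summits.BirchSwinnertonDyer.Rank1Residual.X11b.BDPRouteOpenInputDegenerateFrame
import Literature.NumberTheory.EllipticCurves.CyclotomicIwasawaMainTheoremIrreducibleProofs
import Mathlib.RingTheory.PowerSeries.Derivative
import HarnessLib

/-!
# Node (cruxidea gen 23): TANGENT–MOMENT RIGIDIFICATION of the trace-zero Heegner coset
# — an implied-by node for `UniversalToricDescent.RationalSplitIMCInclusionAtThree` (stmt-24207, RATWALL)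

KIND: implied-by node (D-0171).  The kernel theorem
`rationalSplitIMCInclusionAtThree_of_tangentMomentRigidification : CharGeneratorNeZeroAtThree →
TangentRigidifiedInteriorBoundAtThree → InteriorDivisibilityClosure → RationalSplitIMCInclusionAtThree`
concludes the crux BY NAME with a real proof (no `sorry`, no unsafe options).  Unit
`cruxidea-stmt-BirchSwinnertonDyer-24207-1-g23`; idea card `Ideas/tangent-moment-rigidification.md`; handoff
`HANDOFF-cruxidea-24207-1-g23.md`.

## KEEP/KILL g23
The gen-22 table STANDS unchanged (sweep 2026-08-31: no new Disproof/TRIAGE/Negative file for this crux; negatives index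
for the summit still {15532, 24881}, both disjoint from every live card; LEAD `Lines/ratwall_thin_comb` v3 unchanged).
KEEP: ratwall_thin_comb (LEAD), torsion-anchored-reciprocity (g10, order < 1 door — see §"why order one is accepted
here"), sign-line-tangency (g20, value-ratio pin), root-continuity-ladder (g22), frozen-channel-padic-pin (g9, dormant),
layer ladder cards as instruments.  KILLED stay killed: universal-toric-half-order, germ-recentred-tempered-heegner,
tempered-eisenstein, GU(2,1) transfer.

## THE IDEA (#25, technique class: Amice–Vélu–Višik interpolation WITH ONE MOMENT + tangential Euler-system congruence
## + Kobayashi–Ota interior-prime specialisation; lens = transfer-at-crux-level)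

Every attempt in the cone either LOWERS the order of the anticyclotomic Heegner object below 1 (dead: B-g10-1, B-g19-1,
`traceZero_forces_order_one` in the g10 node, the killed universal-toric-half-order), or LEAVES the anticyclotomic line
for the bounded teeth (LEAD; g9), or pins only VALUES at torsion characters (g10 door, g20 ratios) — and values cannot
pin an order-one object (`B-g5-4`: the coset `c + ℓ·(H¹_Iw ⊗ ℚ)`, `ℓ = log(1+T)`, is all the tower knows).
This node ACCEPTS order exactly one and supplies the missing datum from OUTSIDE the tower:

* (AVV₁) Amice–Vélu / Višik with `h = 1`: an element of `𝓗₁ ⊗ H¹_Iw` is determined by, and can be GLUED from, its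
  ball VALUES and ball FIRST MOMENTS subject to the order-one admissibility congruences; equivalently (Fourier side) an
  order-one function is pinned by its 1-JETS at the torsion points although not by its values: `𝓗₁ ∩ ℓ²·𝒪 = 0` while
  `𝓗₁ ∩ ℓ·𝒪 ∋ ℓ` (typed below as `OrderOneJetIdentityPrinciple`, a TRUE lemma of `3`-adic analysis).
* (TEETH) The first moments come from the two TRANSVERSAL BOUNDED directions through each torsion character `χ` of the
  anticyclotomic line inside the `ℤ₃²`-character plane of `K`: the `𝔭`-tooth (characters `χ·η`, `η` of `𝔭`-power
  conductor — the LEAD's Beilinson–Flach tooth `z_𝔭(χ; ·)`, bounded because the CM family is `𝔭`-ordinary) and its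
  complex-conjugate `𝔭'`-tooth.  The anticyclotomic tangent at `χ` is `∂_𝔭 − ∂_𝔭'`; define the TANGENT MOMENT
  `m_χ := a(χ)⁻¹·∂_η z_𝔭(χ;η)|_{η=1} − a'(χ)⁻¹·∂_{η'} z_𝔭'(χ;η')|_{η'=1} ∈ H¹(K, V_f ⊗ χ)`, where
  `z_𝔭(χ;1) = a(χ)·y^χ`, `z_𝔭'(χ;1) = a'(χ)·y^χ` (tooth values = LEAD K2(b-val); denominators `a(χ)` have bounded
  valuation iff `μ(𝓛̃_𝔭) = 0` — the cheapest falsifier).  This is Kobayashi's 2013 move ("the diagonal direction has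
  non-admissible denominators, but the horizontal and vertical directions have admissible denominators", Invent. Math.
  191, pp. 536–537) transplanted from the analytic to the ALGEBRAIC side, with (ac line; `𝔭`-tooth, `𝔭'`-tooth) in
  place of (diagonal; horizontal, vertical).
* (TMC — the research leaf) TANGENT-MOMENT CONGRUENCE: the data (values `u(χ)·y^χ` on the trace-zero coset, moments
  `m_χ`) satisfy the order-one admissibility congruences.  Its mod-3 shadow is explicit and checkable: the level-`n`
  congruence reads `3·(m restricted to level n) ≡ d_n (mod integral classes)`, `d_n ∈ H¹(K_n, E[3])` the WILD KOLYVAGIN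
  DERIVATIVE class of `y_{n+1}` (trace zero ⇒ `D_σ y_{n+1}` is `G`-invariant mod 3; these classes are `3`-torsion
  shadows — `Tr` one level up kills them — which is exactly why the tower alone never produces a moment, B-g23-4).
* (GLUE + J) AVV₁ gluing gives an HONEST order-one class `c♮ ∈ 𝓗₁ ⊗ H¹_Iw(K_∞^ac, T)` with torsion values in the
  Heegner coset; its `𝔭`-Coleman image is order-one tempered and its 1-jets at torsion points are computed by the
  finite-order `3`-adic Waldspurger formula (values; in the tree behind `WildSplitWaldspurgerAtThree`) and the tooth
  explicit reciprocity laws differentiated once ACROSS the crossing (jets); `OrderOneJetIdentityPrinciple` then pins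
  `Col_𝔭(c♮) = u·3ᵇ·𝓛·(order-one unit factor)` — the JET-PINNED RECIPROCITY.
* (KO) Kobayashi–Ota's interior-prime Kolyvagin argument (Adv. Stud. Pure Math. 86 (2020) Thm 1.1, the `⊗ℚ_p`
  anticyclotomic inclusion for non-ordinary SPLIT `p`, quoted in arXiv:2211.04377 p. 3; Perrin-Riou twist landing in
  `H¹_Iw ⊗ 𝓗_∞`, ibid. p. 8) is ORDER-INSENSITIVE: a tempered class is integral after specialisation at every
  height-one prime `𝔓 ≠ (3)` (interior discs), so Kolyvagin at each `𝔓` (with `p = 3` image input: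
  `ρ̄₃` surjective, `H¹(GL₂(𝔽₃), 𝔽₃²) = 0`) gives the ROOTWISE bound `ord_𝔓 char X_(∅,0) ≤ ord_𝔓 L` for `𝔓 ∤ 3` —
  typed below as the conclusion of `TangentRigidifiedInteriorBoundAtThree` — and UFD algebra in `R₀'⟦T⟧`
  (`InteriorDivisibilityClosure`) turns that into `∃ k, 3ᵏ·L ∈ Ch_Λ(X_(∅,0))·R₀'⟦T⟧`, i.e. RATWALL on the nose
  (the `3ᵏ` is precisely the invisible prime `(3)`; `μ` is the twin's business, TwinSplitIMCTransportAtThree).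

WHY ORDER ONE IS ACCEPTED HERE (answer to B-g10-1 / B-g19-1 / `traceZero_forces_order_one`): nothing is divided by
`ℓ`; the class stays of order exactly one as the barrier demands; rigidity is restored not by lowering the order but by
adding the transversal first moment, and the closing engine (KO interior specialisation) never needs boundedness.

WHY NOVEL (problem-relative; searches in the card): no card in `Ideas/` and no line uses MOMENTS or JETS supplied
transversally — grep of `Ideas/*.md`, `Lines/*.md`, all HANDOFFs for `moment|jet|Višik|admissible distribution|tangent|
wild derivative` finds only g5's dead "derivative-Waldspurger jets / jet-rigidified 𝕃" (jets OF the Heegner/L data,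
killed by B-g5-4 — agreed and used here as the reason the moment must be external), g6/g12's dead "vertical Kolyvagin
derivatives as carriers" (here they are the mod-3 TARGET of the congruence, not carriers) and g20's tangency of the
SIGN LINE (a value-ratio statement, no jets).  Literature: Kobayashi 2013 pp. 536–537 (the transversal-admissible move,
analytic side, cyclotomic variables), Koblitz 1980 p. 103 (Amice–Vélu [5], Višik [94] h-admissible measures),
Kobayashi–Ota 2020 / Kobayashi 2023 (interior primes, `p ≥ 5`, good reduction) — none at additive `p = 3`, none with an
algebraic-side moment.

## PIECES (tags per D-0171) and LEAVES
* `CharGeneratorNeZeroAtThree`            [WEAKER · ATTACKABLE (S)]  torsion `X` ⇒ the generator of `Ch·R₀'⟦T⟧` is `≠ 0`.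
* `TangentRigidifiedInteriorBoundAtThree` [UNDECIDED · door · EQUIV-mod-(NZ, INT) with the wall — costume check
  `tangentRigidifiedInteriorBound_of_wall` below; its CONTENT is the producer chain TMC [IDEA-NEEDED] → AVV₁ gluing
  [ATTACKABLE (M), `3`-adic analysis] → jet-pinned reciprocity [UNDECIDED; needs LEAD K2(b-val) + one transversal
  derivative of the tooth ERL; typed core `OrderOneJetIdentityPrinciple`, ATTACKABLE (M)] → KO interior Kolyvagin at
  `p = 3` [ATTACKABLE (L)].  This chain is the CHILD the EQUIV tag owes.]
* `InteriorDivisibilityClosure`           [WEAKER · TRUE commutative algebra · ATTACKABLE (M)]  (`R₀'⟦T⟧` regular local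
  of dimension 2 ⇒ UFD; or Weierstrass preparation + Gauss lemma over the DVR `R₀'`).
* `OrderOneJetIdentityPrinciple`          [WEAKER · TRUE `3`-adic analysis · ATTACKABLE (M)]  leaf of the door's producer
  (not consumed by the kernel: the door's typed residue is already rootwise).
LEAVES: TMC = IDEA-NEEDED (instrument I-g23-1: `μ(𝓛̃_𝔭) = 0` on an O6 row, e.g. the 135a-type habitat — bounded
denominators `a(χ)`; I-g23-2: the `n = 0` shadow `3·m_𝟙 ≡ d_0` against a 3-descent over `K` and `K_1`);
jet-pinned reciprocity = INSTRUMENTABLE once LEAD K2(b-val) is in hand; KO at `p = 3`, AVV₁, INT, NZ, JET = ATTACKABLE.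
BARRIERS: TraceZero… (honoured: values are only a coset; order one kept), NoAdmissiblePrimesAtThree (unused: Kolyvagin
primes are inert `ℓ ∤ 3N`, interior primes are primes of `R₀'⟦T⟧`), B-g37-1/B-g14-1 (output is Λ-adic-tempered and
specialised at interior height-one primes, never pointwise torsion valuations), B-g5-4 (answered: moments external).
-/

set_option autoImplicit false
set_option linter.dupNamespace false

noncomputable section

open scoped Classical

namespace Summit.BirchSwinnertonDyer.BirchSwinnertonDyer.Cruxes.RationalSplitIMCInclusionAtThree.TangentMomentRigidification

open PowerSeries Literature.NumberTheory.EllipticCurves Summit.BirchSwinnertonDyer.Rank1Residual.X11b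

/-! ## §1 `3`-adic analytic vocabulary: torsion points, tempered series, values, the order-one jet principle -/

/-- The TORSION POINTS `x = ζ - 1` of the open unit disc of `ℂ₃` (verbatim from the g10 node, shared leaf). -/
def torsionPoints : Set ℂ_[3] := {x | ∃ (n : ℕ) (ζ : ℂ_[3]), IsPrimitiveRoot ζ (3 ^ n) ∧ x = ζ - 1}

/-- `F ∈ ℂ₃⟦T⟧` is TEMPERED OF ORDER `≤ r` (Perrin-Riou's `𝓗_r`, integer `r`): `‖aₙ‖ = O((n+1)^r)`. -/
def IsTempered (r : ℕ) (F : PowerSeries ℂ_[3]) : Prop :=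
  ∃ C : ℝ, ∀ n : ℕ, ‖PowerSeries.coeff n F‖ ≤ C * ((n : ℝ) + 1) ^ r

/-- `F` takes the value `v` at the point `x` of the open disc (`Σ aₙ xⁿ` sums to `v`). -/
def EvalsTo (F : PowerSeries ℂ_[3]) (x v : ℂ_[3]) : Prop :=
  HasSum (fun n : ℕ => PowerSeries.coeff n F * x ^ n) v

/-- **JET [WEAKER · TRUE · ATTACKABLE (M)]** ORDER-ONE JET IDENTITY PRINCIPLE: an order-one tempered function whose
1-jet vanishes at every torsion point is zero — `𝓗₁ ∩ ℓ²·𝒪 = 0` (`ℓ = log(1+T)` has simple zeros exactly at the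
torsion points and Gauss norms `|ℓ|_{ρₙ} ≍ 3ⁿ`; Gauss norms are multiplicative and non-decreasing in `ρ`, and
`|F|_{ρₙ} = O(3ⁿ)`, so `F/ℓ²` has Gauss norms `→ 0`, hence vanishes).  Contrast: VALUES alone pin nothing of order one
(`ℓ` itself vanishes at all torsion points) — the formal content of B-g5-4 and the reason the FIRST MOMENT is needed. -/
def OrderOneJetIdentityPrinciple : Prop :=
  ∀ F : PowerSeries ℂ_[3], IsTempered 1 F →
    (∀ x ∈ torsionPoints, EvalsTo F x 0 ∧ EvalsTo (PowerSeries.derivativeFun F) x 0) → F = 0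

/-! ## §2 The algebraic closing step and the door -/

/-- **INT [WEAKER · TRUE commutative algebra · ATTACKABLE (M)]** INTERIOR DIVISIBILITY CLOSURE in `R₀'⟦T⟧`: if `F ≠ 0`
and `ord_q F ≤ ord_q L` at every prime `q ∤ 3` (the interior height-one primes), then `3ᵏ·L ∈ (F)` for some `k`
(take `k = ord₃ F`; `R₀'⟦T⟧` is a UFD).  This is exactly how a ROOTWISE bound away from `(3)` becomes the RATIONAL
inclusion: the lost power of `3` is the `3ᵏ` of the wall. -/
def InteriorDivisibilityClosure : Prop :=
  ∀ F Lx : UnrSeries 3, F ≠ 0 →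
    (∀ q : UnrSeries 3, Prime q → ¬ (q ∣ ((3 : ℕ) : UnrSeries 3)) → ∀ n : ℕ, q ^ n ∣ F → q ^ n ∣ Lx) →
      ∃ k : ℕ, ((3 : ℕ) : UnrSeries 3) ^ k * Lx ∈ Ideal.span {F}

/-- **NZ [WEAKER · ATTACKABLE (S)]** for torsion `X_(∅,0)` the generator `F` of `Ch_Λ(X)·R₀'⟦T⟧` is nonzero
(`Ch_Λ` of a torsion module is `≠ ⊥`, and `PowerSeries.map (Halves.toUnr 3)` is injective). -/
def CharGeneratorNeZeroAtThree : Prop :=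
  ∀ (K : Type) [Field K] [NumberField K] (W : WeierstrassCurve K) (κ : ZpExtension K 3)
    (𝔭' : IsDedekindDomain.HeightOneSpectrum (NumberField.RingOfIntegers K)) (γ : Field.absoluteGaloisGroup K)
    [Fact (κ.IsTopGenerator γ)],
    Module.IsTorsion (IwasawaAlgebra 3) (AcSelmer.XAc W 3 κ 𝔭' ∅ γ) →
      ∀ F : UnrSeries 3, (AcSelmer.XAc.charIdeal W 3 κ 𝔭' ∅ γ).map (PowerSeries.map (Halves.toUnr 3)) =
        Ideal.span {F} → F ≠ 0

/-- **DOOR [UNDECIDED · EQUIV-mod-(NZ, INT) with the wall — costume check `tangentRigidifiedInteriorBound_of_wall`]**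
TANGENT-RIGIDIFIED INTERIOR BOUND at `p = 3`: on the wall's binders, with `X_(∅,0)` torsion and `Ch_Λ(X)·R₀'⟦T⟧ = (F)`,
every interior prime power dividing `F` divides the BDP frame `L`: `q` prime, `q ∤ 3`, `qⁿ ∣ F ⇒ qⁿ ∣ L`.
PRODUCER (the child of this EQUIV piece, see header): tangent-moment congruence (IDEA-NEEDED) → AVV₁ gluing of an honest
order-one class `c♮` → jet-pinned reciprocity (`OrderOneJetIdentityPrinciple` + tooth ERL 1-jets + finite-order
Waldspurger) → Kobayashi–Ota Kolyvagin at each height-one `𝔓 ∤ 3` (order-insensitive). -/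
def TangentRigidifiedInteriorBoundAtThree : Prop :=
  ∀ (W : WeierstrassCurve ℚ) [W.IsElliptic] [W.IsGloballyMinimal] (N : ℕ) [NeZero N] (K : Type) [Field K] [NumberField K] (Dt : Literature.NumberTheory.EllipticCurves.ModularForms.ModularParametrizationData W N), Summit.BirchSwinnertonDyer.Rank1Residual.Additive.ClassO6 W 3 → W.HasSurjectiveModNGaloisRep 3 → W.analyticRank = 1 → W.conductorNorm ℤ = N → Literature.NumberTheory.EllipticCurves.IsImaginaryQuadratic K → Literature.NumberTheory.EllipticCurves.SatisfiesHeegnerHypothesis N K → ∀ (κ : Literature.NumberTheory.EllipticCurves.ZpExtension K 3), κ.IsAnticyclotomic → ∀ (γ : Field.absoluteGaloisGroup K) [Fact (κ.IsTopGenerator γ)] (𝔭 : IsDedekindDomain.HeightOneSpectrum (NumberField.RingOfIntegers K)), ((3 : ℕ) : NumberField.RingOfIntegers K) ∈ 𝔭.asIdeal → 𝔭.asIdeal.ramificationIdx (NumberField.RingOfIntegers ℚ) = 1 → 𝔭.asIdeal.inertiaDeg (NumberField.RingOfIntegers ℚ) = 1 → ∀ (𝔭' : IsDedekindDomain.HeightOneSpectrum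 (NumberField.RingOfIntegers K)), ((3 : ℕ) : NumberField.RingOfIntegers K) ∈ 𝔭'.asIdeal → 𝔭' ≠ 𝔭 → ∀ (ι' : PadicAlgCl 3 ≃+* ℂ), Summit.BirchSwinnertonDyer.BirchSwinnertonDyer.Theorems.SchneiderFree.BranchInducesPrime 3 ι' 𝔭 → ∀ (ΩK : ℂ) (Ωp : ℂ_[3]) (L : Literature.NumberTheory.EllipticCurves.UnrSeries 3), ΩK ≠ 0 → Ωp ≠ 0 → Literature.NumberTheory.EllipticCurves.IsBDPLFunction ι' 𝔭 κ γ Dt.f ΩK Ωp L → Module.IsTorsion (Literature.NumberTheory.EllipticCurves.IwasawaAlgebra 3) (Summit.BirchSwinnertonDyer.Rank1Residual.X11b.AcSelmer.XAc (W.baseChange K) 3 κ 𝔭' ∅ γ) → ∀ F : Literature.NumberTheory.EllipticCurves.UnrSeries 3, (Summit.BirchSwinnertonDyer.Rank1Residual.X11b.AcSelmer.XAc.charIdeal (W.baseChange K) 3 κ 𝔭' ∅ γ).map (PowerSeries.map (Summit.BirchSwinnertonDyer.Rank1Residual.X11b.Halves.toUnr 3)) = Ideal.span {F} →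
    ∀ q : Literature.NumberTheory.EllipticCurves.UnrSeries 3, Prime q →
      ¬ (q ∣ ((3 : ℕ) : Literature.NumberTheory.EllipticCurves.UnrSeries 3)) → ∀ n : ℕ, q ^ n ∣ F → q ^ n ∣ L

/-! ### Helper fact (gen-3…10 currency, verbatim) -/

/-- The extended characteristic ideal is principal: `Ch_Λ(X)·R₀'⟦T⟧ = (F)`. -/
theorem exists_map_charIdeal_eq_span {K : Type} [Field K] [NumberField K] (W : WeierstrassCurve K)
    (κ : ZpExtension K 3) (𝔭' : IsDedekindDomain.HeightOneSpectrum (NumberField.RingOfIntegers K))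
    (γ : Field.absoluteGaloisGroup K) [Fact (κ.IsTopGenerator γ)] :
    ∃ F : UnrSeries 3, (AcSelmer.XAc.charIdeal W 3 κ 𝔭' ∅ γ).map (PowerSeries.map (Halves.toUnr 3)) =
      Ideal.span {F} := by
  obtain ⟨f, hf⟩ := (charIdeal_isPrincipal_holds 3 (AcSelmer.XAc W 3 κ 𝔭' ∅ γ)).principal
  refine ⟨PowerSeries.map (Halves.toUnr 3) f, ?_⟩
  have hf' : AcSelmer.XAc.charIdeal W 3 κ 𝔭' ∅ γ = Ideal.span {f} := by
    change Literature.NumberTheory.EllipticCurves.Module.charIdeal (IwasawaAlgebra 3) (AcSelmer.XAc W 3 κ 𝔭' ∅ γ) =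
      Ideal.span {f}
    simpa [Ideal.submodule_span_eq] using hf
  rw [hf', Ideal.map_span, Set.image_singleton]

/-! ## §3 The composition (kernel-checked) -/

/-- **KERNEL.** `NZ → DOOR → INT → RationalSplitIMCInclusionAtThree`.  If `X_(∅,0)` is not Λ-torsion then
`Ch_Λ(X) = ⊤` and `k = 0` works.  Otherwise `Ch·R₀'⟦T⟧ = (F)` with `F ≠ 0` (NZ); the DOOR gives the rootwise bound at
every interior prime; INT converts it into `3ᵏ·L ∈ (F)`. -/
theorem rationalSplitIMCInclusionAtThree_of_tangentMomentRigidification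
    (hNZ : CharGeneratorNeZeroAtThree) (hD : TangentRigidifiedInteriorBoundAtThree)
    (hI : InteriorDivisibilityClosure) :
    Summit.BirchSwinnertonDyer.BirchSwinnertonDyer.Theses.UniversalToricDescent.RationalSplitIMCInclusionAtThree := by
  intro W _ _ N _ K _ _ Dt hO6 hsurj hr1 hN hK hH κ hκ γ _ 𝔭 h𝔭 he hf 𝔭' h𝔭' hne ι' hι ΩK Ωp L hΩK hΩp hL
  by_cases htor : Module.IsTorsion (IwasawaAlgebra 3) (AcSelmer.XAc (W.baseChange K) 3 κ 𝔭' ∅ γ)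
  · obtain ⟨F, hF⟩ := exists_map_charIdeal_eq_span (W.baseChange K) κ 𝔭' γ
    have hF0 : F ≠ 0 := hNZ K (W.baseChange K) κ 𝔭' γ htor F hF
    have hroot : ∀ q : UnrSeries 3, Prime q → ¬ (q ∣ ((3 : ℕ) : UnrSeries 3)) → ∀ n : ℕ, q ^ n ∣ F → q ^ n ∣ L :=
      hD W N K Dt hO6 hsurj hr1 hN hK hH κ hκ γ 𝔭 h𝔭 he hf 𝔭' h𝔭' hne ι' hι ΩK Ωp L hΩK hΩp hL htor F hF
    obtain ⟨k, hk⟩ := hI F L hF0 hroot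
    exact ⟨k, by rw [hF]; exact hk⟩
  · refine ⟨0, ?_⟩
    have htop : AcSelmer.XAc.charIdeal (W.baseChange K) 3 κ 𝔭' ∅ γ = ⊤ :=
      Summit.BirchSwinnertonDyer.BirchSwinnertonDyer.Theorems.charIdeal_eq_top_of_not_isTorsion (p := 3) _ htor
    rw [htop, Ideal.map_top]; exact Submodule.mem_top

/-- **Costume check (evidence for the EQUIV-mod-(NZ, INT) tag of the DOOR):** the wall gives the DOOR — from
`3ᵏ·L ∈ (F)` every prime power `qⁿ ∣ F` with `q ∤ 3` divides `3ᵏ·L`, hence `L`.  So the DOOR carries content only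
through its informal producer (tangent moments, AVV₁ gluing, jet-pinned reciprocity, interior Kolyvagin); its typed
residue is the rootwise reading of the wall. -/
theorem tangentRigidifiedInteriorBound_of_wall
    (h : Summit.BirchSwinnertonDyer.BirchSwinnertonDyer.Theses.UniversalToricDescent.RationalSplitIMCInclusionAtThree) :
    TangentRigidifiedInteriorBoundAtThree := by
  intro W _ _ N _ K _ _ Dt hO6 hsurj hr1 hN hK hH κ hκ γ _ 𝔭 h𝔭 he hf 𝔭' h𝔭' hne ι' hι ΩK Ωp L hΩK hΩp hL _ F hF
    q hq hq3 n hqn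
  obtain ⟨k, hk⟩ := h W N K Dt hO6 hsurj hr1 hN hK hH κ hκ γ 𝔭 h𝔭 he hf 𝔭' h𝔭' hne ι' hι ΩK Ωp L hΩK hΩp hL
  rw [hF] at hk
  have hFd : F ∣ ((3 : ℕ) : UnrSeries 3) ^ k * L := Ideal.mem_span_singleton.mp hk
  exact hq.pow_dvd_of_dvd_mul_left n (fun h3 => hq3 (hq.dvd_of_dvd_pow h3)) (dvd_trans hqn hFd)

/-- **Sanity for INT (PROVED special case):** when `F` is itself a power of an interior prime, the rootwise hypothesis
already gives the inclusion with `k = 0` — the `3ᵏ` of the wall is born only at the prime `(3)`. -/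
theorem interiorDivisibility_primePow (q : UnrSeries 3) (m : ℕ) (Lx : UnrSeries 3)
    (hroot : ∀ n : ℕ, q ^ n ∣ q ^ m → q ^ n ∣ Lx) :
    ((3 : ℕ) : UnrSeries 3) ^ 0 * Lx ∈ Ideal.span {q ^ m} := by
  rw [pow_zero, one_mul]
  exact Ideal.mem_span_singleton.mpr (hroot m dvd_rfl)

end Summit.BirchSwinnertonDyer.BirchSwinnertonDyer.Cruxes.RationalSplitIMCInclusionAtThree.TangentMomentRigidification

end
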